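import Summits.CriticalPhenomena.PercolationContinuityZ3.Theorems.PercNearOneGluingNoHeavyLowerTailThreePartitionGridOrOrTwisted
import HarnessLib.Audit

/-!
# `NoHeavyLowerTail` (crux stmt-CriticalPhenomena-4575), master-family hierarchy P3 (gen 36): the TYPED matching for TWO DISJUNCTIONS WITH AN
# ARBITRARY TWIST, part 2 — the decoder is a left inverse; `TypedMatchable τ (OR P) (OR Q)` for every `τ, P, Q`

Support file (seat `prim-masterthm-p3`; `--supports stmt-CriticalPhenomena-4575`; memo
`run/shared/lean/prim/prim-masterthm/FROM-prim-masterthm-p3-g36-CYLINDER-SLACK.md` §10).  Part 1 is `…ThreePartitionGridOrOrTwisted` (`mvL`/`mvK`/`mvE`,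
`cp_mvL`/`cp_mvK`/`cp_mvE`, `ororMapT`, `ororInvT`, `ororMapT_spec`).  Here: `ororInvT_ororMapT` — branch by branch the decoder recognises the image
(the copies of the moved configuration are supplied by the move calculus) and undoes the move by the involutions `mvL_mvL`, `mvK_mvK`, `mvE_mvE` —
and the assembly `typedMatchable_orOrT (τ P Q : Set ι) : TypedMatchable τ (orFam P) (orFam Q)` (injectivity from the left inverse), with the
grid-order matching `gtMatchable_orOrT`.  This supersedes the untwisted `typedMatchable_orOr` of `…GridOrOrMatching` (the case `τ = ∅`).
HONEST LABEL: the OR–OR class of the OPEN conjecture `TypedGridMatching`, now for every twist; `GridTransport` / COMB-C3 / Sahi's `C₃` for general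
up-sets remain OPEN; nothing bears on the (closed) crux. [this work]
-/

noncomputable section

open Finset
open scoped symmDiff Classical

namespace Summit.CriticalPhenomena.PercolationContinuityZ3.Theorems.ThreePartition

variable {ι : Type*}

/-! ## The decoder is a left inverse -/

variable [Fintype ι]

/-- **Left inverse**: `ororInvT (ororMapT t) = t` for every negative token `t`. [this work] -/
theorem ororInvT_ororMapT (τ P Q : Set ι) {t : (Set ι × Set ι) × Fin 3} (ht : t ∈ negToks τ (orFam P) (orFam Q)) :
    ororInvT τ P Q (ororMapT τ P Q t) = t := by
  obtain ⟨q, i⟩ := t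
  rw [mem_negToks_iff] at ht
  obtain ⟨hdis, hk⟩ := ht
  dsimp only at hdis hk ⊢
  have hcov : ∀ c, c ∈ cp₁ τ q ∨ c ∈ cp₂ τ q ∨ c ∈ cp₃ τ q := mem_cp_cover τ q
  have fin10 : ¬ ((1 : Fin 3) = 0) := by decide
  have fin20 : ¬ ((2 : Fin 3) = 0) := by decide
  have fin21 : ¬ ((2 : Fin 3) = 1) := by decide
  rcases hk with ⟨rfl, hV, hW⟩ | ⟨rfl, hW1, hV2⟩ | ⟨rfl, hP2, hQ2⟩
  · -- N1
    rw [mem_orFam] at hV hW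
    simp only [ororMapT, if_true]
    split_ifs with h1 h2 h3
    · -- self
      simp only [ororInvT, if_true]
      rw [if_pos hW]
    · -- diversion 1
      obtain ⟨h2a, _, _⟩ := h2
      have hx1Q : ∀ a, a ∈ cp₁ τ q → a ∈ Q → False := fun a ha haQ => h1 ⟨a, ha, haQ⟩
      have hx2P : ∀ a, a ∈ cp₂ τ q → a ∈ P → a ∈ Q := fun a ha haP => by
        by_contra haQ
        have : a ∈ P \ Q ∩ cp₂ τ q := ⟨⟨haP, haQ⟩, ha⟩
        rw [h2a] at this; exact this
      have hm : cp₂ τ q ∩ (P ∩ Q) ⊆ cp₂ τ q \ cp₁ τ q := fun c hc => ⟨hc.1, fun hc1 => h1 ⟨c, hc1, hc.2.2⟩⟩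
      obtain ⟨e1, e2, e3, -⟩ := cp_mvK τ hdis hm
      simp only [ororInvT, fin10, if_false, if_true, e1, e2, e3]
      have c1 : ¬ ((cp₂ τ q \ (cp₂ τ q ∩ (P ∩ Q))) ∩ P).Nonempty := by
        rintro ⟨a, ⟨ha2, haT⟩, haP⟩; exact haT ⟨ha2, haP, hx2P a ha2 haP⟩
      have c2 : ¬ ((cp₁ τ q ∪ cp₂ τ q ∩ (P ∩ Q)) ∩ (Q \ P)).Nonempty := by
        rintro ⟨a, ha | ha, haQP⟩
        · exact hx1Q a ha haQP.1
        · exact haQP.2 ha.2.1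
      rw [if_neg c1, if_neg c2, if_pos hW]
      have hmT : (cp₁ τ q ∪ cp₂ τ q ∩ (P ∩ Q)) ∩ (P ∩ Q) = cp₂ τ q ∩ (P ∩ Q) := by
        ext c; simp only [Set.mem_inter_iff, Set.mem_union]
        constructor
        · rintro ⟨hc | hc, hcT⟩
          · exact absurd hcT.2 (fun h => hx1Q c hc h)
          · exact hc
        · intro hc; exact ⟨Or.inr hc, hc.2⟩
      rw [hmT, mvK_mvK]
    · -- diversion 2
      obtain ⟨h3a, h3b, h3c⟩ := h3
      have hx1Q : ∀ a, a ∈ cp₁ τ q → a ∈ Q → False := fun a ha haQ => h1 ⟨a, ha, haQ⟩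
      have hx2T : ¬ (cp₂ τ q ∩ (P ∩ Q)).Nonempty := fun h => h2 ⟨h3a, h3b, h⟩
      have hm : P ∩ Q ⊆ cp₃ τ q \ cp₁ τ q := fun c hc =>
        ⟨by have : c ∈ cp₃ τ q ∩ Q := by rw [h3c]; exact hc
            exact this.1, fun hc1 => h1 ⟨c, hc1, hc.2⟩⟩
      obtain ⟨e1, e2, e3, -⟩ := cp_mvL τ hdis hm
      simp only [ororInvT, fin10, if_false, if_true, e1, e2, e3]
      have c1 : ¬ (cp₂ τ q ∩ P).Nonempty := by
        rintro ⟨a, ha2, haP⟩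
        by_cases haQ : a ∈ Q
        · exact hx2T ⟨a, ha2, haP, haQ⟩
        · have : a ∈ P \ Q ∩ cp₂ τ q := ⟨⟨haP, haQ⟩, ha2⟩
          rw [h3a] at this; exact this
      have c2 : ¬ ((cp₁ τ q ∪ P ∩ Q) ∩ (Q \ P)).Nonempty := by
        rintro ⟨a, ha | ha, haQP⟩
        · exact hx1Q a ha haQP.1
        · exact haQP.2 ha.1
      have c3 : ¬ ((cp₃ τ q \ (P ∩ Q)) ∩ Q).Nonempty := by
        rintro ⟨a, ⟨ha3, haT⟩, haQ⟩
        have : a ∈ cp₃ τ q ∩ Q := ⟨ha3, haQ⟩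
        rw [h3c] at this; exact haT this
      rw [if_neg c1, if_neg c2, if_neg c3, mvL_mvL]
    · -- canonical landing
      have hx1Q : ∀ a, a ∈ cp₁ τ q → a ∈ Q → False := fun a ha haQ => h1 ⟨a, ha, haQ⟩
      have hm : cp₃ τ q ∩ Q ⊆ cp₃ τ q \ cp₁ τ q := fun c hc => ⟨hc.1, fun hc1 => h1 ⟨c, hc1, hc.2⟩⟩
      obtain ⟨e1, e2, e3, -⟩ := cp_mvL τ hdis hm
      simp only [ororInvT, if_true, e1, e2, e3]
      have hmQ : (cp₁ τ q ∪ cp₃ τ q ∩ Q) ∩ Q = cp₃ τ q ∩ Q := by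
        ext c; simp only [Set.mem_inter_iff, Set.mem_union]
        constructor
        · rintro ⟨hc | hc, hcQ⟩
          · exact absurd hcQ (fun h => hx1Q c hc h)
          · exact hc
        · intro hc; exact ⟨Or.inr hc, hc.2⟩
      have c1 : ¬ ((cp₃ τ q \ (cp₃ τ q ∩ Q)) ∩ Q).Nonempty := by
        rintro ⟨a, ⟨ha3, han⟩, haQ⟩; exact han ⟨ha3, haQ⟩
      have c2 : ((cp₁ τ q ∪ cp₃ τ q ∩ Q) ∩ (P \ Q)).Nonempty ∧
          ((cp₂ τ q ∩ (P \ Q)).Nonempty ∨ (cp₂ τ q ∩ (P ∩ Q) = ∅ ∧ (cp₁ τ q ∪ cp₃ τ q ∩ Q) ∩ Q ≠ P ∩ Q)) := by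
        obtain ⟨b, hb⟩ := hV
        refine ⟨⟨b, Or.inl hb.1, hb.2, fun h => hx1Q b hb.1 h⟩, ?_⟩
        by_cases hx2 : P \ Q ∩ cp₂ τ q = ∅
        · right
          have hb1 : (P \ Q ∩ cp₁ τ q).Nonempty := ⟨b, ⟨hb.2, fun h => hx1Q b hb.1 h⟩, hb.1⟩
          have hT2 : cp₂ τ q ∩ (P ∩ Q) = ∅ := by
            by_contra hne
            exact h2 ⟨hx2, hb1, Set.nonempty_iff_ne_empty.2 hne⟩
          refine ⟨hT2, ?_⟩
          rw [hmQ]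
          exact fun h => h3 ⟨hx2, hb1, h⟩
        · left
          obtain ⟨a, ha⟩ := Set.nonempty_iff_ne_empty.2 hx2
          exact ⟨a, ha.2, ha.1⟩
      rw [if_neg c1, if_pos c2, hmQ, mvL_mvL]
  · -- N2
    rw [mem_orFam] at hW1 hV2
    simp only [ororMapT, fin10, if_false, if_true]
    split_ifs with h1
    · simp only [ororInvT, fin10, if_false, if_true]
      rw [if_pos hV2]
    · have hm : cp₂ τ q ∩ P ⊆ cp₂ τ q \ cp₁ τ q := fun c hc => ⟨hc.1, fun hc1 => h1 ⟨c, hc1, hc.2⟩⟩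
      obtain ⟨e1, e2, e3, -⟩ := cp_mvK τ hdis hm
      simp only [ororInvT, fin10, if_false, if_true, e1, e2, e3]
      have c1 : ¬ ((cp₂ τ q \ (cp₂ τ q ∩ P)) ∩ P).Nonempty := by
        rintro ⟨a, ⟨ha2, han⟩, haP⟩; exact han ⟨ha2, haP⟩
      have c2 : ((cp₁ τ q ∪ cp₂ τ q ∩ P) ∩ (Q \ P)).Nonempty := by
        obtain ⟨a, ha⟩ := hW1
        exact ⟨a, Or.inl ha.1, ha.2, fun h => h1 ⟨a, ha.1, h⟩⟩
      have hmP : (cp₁ τ q ∪ cp₂ τ q ∩ P) ∩ P = cp₂ τ q ∩ P := by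
        ext c; simp only [Set.mem_inter_iff, Set.mem_union]
        constructor
        · rintro ⟨hc | hc, hcP⟩
          · exact absurd ⟨c, hc, hcP⟩ h1
          · exact hc
        · intro hc; exact ⟨Or.inr hc, hc.2⟩
      rw [if_neg c1, if_pos c2, hmP, mvK_mvK]
  · -- N3
    rw [mem_orFam] at hP2 hQ2
    simp only [ororMapT, fin20, fin21, if_false]
    split_ifs with h1 h2 h3
    · -- own T₂
      simp only [ororInvT, fin20, fin21, if_false]
      rw [if_pos hQ2]
    · -- exit
      have hm : cp₂ τ q ∩ Q ⊆ cp₂ τ q \ cp₃ τ q := fun c hc => ⟨hc.1, fun hc3 => h1 ⟨c, hc3, hc.2⟩⟩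
      obtain ⟨e1, e2, e3, -⟩ := cp_mvE τ hdis hm
      simp only [ororInvT, fin20, fin21, if_false, e1, e2, e3]
      have c1 : ¬ ((cp₂ τ q \ (cp₂ τ q ∩ Q)) ∩ Q).Nonempty := by
        rintro ⟨a, ⟨ha2, han⟩, haQ⟩; exact han ⟨ha2, haQ⟩
      have hm' : (cp₃ τ q ∪ cp₂ τ q ∩ Q) ∩ Q = cp₂ τ q ∩ Q := by
        ext c; simp only [Set.mem_inter_iff, Set.mem_union]
        constructor
        · rintro ⟨hc | hc, hcQ⟩
          · exact absurd ⟨c, hc, hcQ⟩ h1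
          · exact hc
        · intro hc; exact ⟨Or.inr hc, hc.2⟩
      rw [if_neg c1, hm', mvE_mvE]
    · -- shift
      obtain ⟨hT1, hrest⟩ := h3
      have hm : P ∩ Q ⊆ cp₂ τ q \ cp₁ τ q := fun c hc => by
        have hc1 : c ∉ cp₁ τ q := fun hc1 => by
          have : c ∈ cp₁ τ q ∩ (P ∩ Q) := ⟨hc1, hc⟩
          rw [hT1] at this; exact this
        refine ⟨?_, hc1⟩
        rcases hcov c with h | h | h
        · exact absurd h hc1
        · exact h
        · exact absurd ⟨c, h, hc.2⟩ h1
      obtain ⟨e1, e2, e3, -⟩ := cp_mvK τ hdis hm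
      simp only [ororInvT, if_true, e1, e2, e3]
      have c2 : ¬ (((cp₁ τ q ∪ P ∩ Q) ∩ (P \ Q)).Nonempty ∧
          (((cp₂ τ q \ (P ∩ Q)) ∩ (P \ Q)).Nonempty ∨
            ((cp₂ τ q \ (P ∩ Q)) ∩ (P ∩ Q) = ∅ ∧ (cp₁ τ q ∪ P ∩ Q) ∩ Q ≠ P ∩ Q))) := by
        rintro ⟨⟨b, hb⟩, hor⟩
        have hb1 : b ∈ cp₁ τ q := hb.1.elim id fun h => absurd h.2 hb.2.2
        have hA1 : ¬ (P \ Q ∩ cp₁ τ q = ∅) := fun h => by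
          have : b ∈ P \ Q ∩ cp₁ τ q := ⟨hb.2, hb1⟩
          rw [h] at this; exact this
        rcases hrest with ⟨hL, hA | hQ1⟩ | ⟨_, hA, _⟩
        · exact hA1 hA
        · rcases hor with ⟨a, ha⟩ | ⟨_, hne⟩
          · exact hL ⟨a, ha.1.1, ha.2⟩
          · apply hne
            ext c; simp only [Set.mem_inter_iff, Set.mem_union]
            constructor
            · rintro ⟨hc | hc, hcQ⟩
              · exfalso
                have : c ∈ cp₁ τ q ∩ Q := ⟨hc, hcQ⟩
                rw [hQ1] at this; exact this
              · exact hc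
            · intro hc; exact ⟨Or.inr hc, hc.2⟩
        · exact hA1 hA
      have c3 : ¬ (((cp₂ τ q \ (P ∩ Q)) ∩ P).Nonempty ∧ ((cp₂ τ q \ (P ∩ Q)) ∩ Q).Nonempty) := by
        rintro ⟨⟨a, ⟨ha2, haT⟩, haP⟩, ⟨a', ⟨ha2', haT'⟩, haQ'⟩⟩
        rcases hrest with ⟨hL, _⟩ | ⟨_, _, hQT⟩
        · exact hL ⟨a, ha2, haP, fun haQ => haT ⟨haP, haQ⟩⟩
        · have : a' ∈ cp₂ τ q ∩ Q := ⟨ha2', haQ'⟩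
          rw [hQT] at this; exact haT' this
      rw [if_neg h1, if_neg c2, if_neg c3, mvK_mvK]
    · -- own unit a
      simp only [ororInvT, if_true]
      have c2 : ¬ ((cp₁ τ q ∩ (P \ Q)).Nonempty ∧
          ((cp₂ τ q ∩ (P \ Q)).Nonempty ∨ (cp₂ τ q ∩ (P ∩ Q) = ∅ ∧ cp₁ τ q ∩ Q ≠ P ∩ Q))) := by
        rintro ⟨⟨b, hb⟩, hor⟩
        have hL : ¬ (cp₂ τ q ∩ (P \ Q)).Nonempty := fun hL => h2 ⟨hL, Or.inl ⟨b, hb.2, hb.1⟩⟩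
        rcases hor with hL' | ⟨hT2, _⟩
        · exact hL hL'
        · obtain ⟨a, ha2, haP⟩ := hP2
          by_cases haQ : a ∈ Q
          · have : a ∈ cp₂ τ q ∩ (P ∩ Q) := ⟨ha2, haP, haQ⟩
            rw [hT2] at this; exact this
          · exact hL ⟨a, ha2, haP, haQ⟩
      rw [if_neg h1, if_neg c2, if_pos ⟨hP2, hQ2⟩]

/-! ## The theorem -/

/-- **`TypedMatchable τ (OR P) (OR Q)` for EVERY twist `τ` and all `P, Q`.** [this work] -/
theorem typedMatchable_orOrT (τ P Q : Set ι) : TypedMatchable τ (orFam P) (orFam Q) :=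
  ⟨ororMapT τ P Q, fun _ ht => ororMapT_spec τ P Q ht, fun t ht t' ht' h => by
    have e := congrArg (ororInvT τ P Q) h
    rwa [ororInvT_ororMapT τ P Q ht, ororInvT_ororMapT τ P Q ht'] at e⟩

/-- Hence a grid-order token matching for every twisted OR–OR instance. [this work] -/
theorem gtMatchable_orOrT (τ P Q : Set ι) : GTMatchable τ (orFam P) (orFam Q) :=
  gtMatchable_of_typedMatchable (typedMatchable_orOrT τ P Q)

end Summit.CriticalPhenomena.PercolationContinuityZ3.Theorems.ThreePartition

end
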